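import Mathlib
import HarnessLib
import Literature.Geometry.DiscreteGeometry.KissingPatterns

/-!
# FrustratedLawDichotomy · crux `AperiodicFrustratedLawGap` (stmt-AtomisticToContinuum-27623) — THE CNA SIGNATURE OF A ROBUSTLY GOOD SITE
# (census instrument for the `#good` term of `FDG`; decomp-a2c, prover hand 2, structural share, generation 7; route-independent module)

The finite residual `FDG` (`FrustratedLawDichotomyLocalCloseOrderFinite`) refunds ROBUSTLY GOOD sites — shells `t : Pat → ℝ³` with
`‖(t u − p) − d•A u‖ ≤ η·d`, `η < 1/20`, `Pat` the fcc (cuboctahedron) or hcp (anticuboctahedron) kissing pattern.  A census instrument must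
CERTIFY that a given site of a finite cluster is NOT robustly good without optimising over rotations `A`.  This file provides the rotation-free
necessary condition (the common-neighbour / contact signature «421/422» of close packing):

* `fcc_contacts`, `hcp_contacts` (integer arithmetic, `decide`): in either pattern every vector has EXACTLY FOUR pattern vectors at distance `1`
  (squared integer norm `2`, resp. `18`) and all other pattern vectors at distance `≥ √2` (squared integer norm `≥ 4`, resp. `≥ 36`);
* `dist_shell_sub_le` : for a shell as above (any `η ≥ 0`), `|dist (t u) (t v) − d·dist u v| ≤ 2η·d`;
* `robustGood_dichotomy_fcc` / `_hcp` : with `η ≤ 1/20`, any two shell atoms are either CONTACTS, `dist ≤ 11/10·d` (pattern distance `1`), or FAR,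
  `dist ≥ 131/100·d` (pattern distance `≥ √2`) — nothing in between;
* `robustGood_four_contacts_fcc` / `_hcp` : every shell atom has EXACTLY FOUR shell atoms within `11/10·d`.

Hence (census reading): a site whose `13/10·d`-shell has an atom with five or more shell atoms within `11/10·d` of it (icosahedral `555`
environments: every shell atom has five shell neighbours at `1.0515·d`), or fewer than four, or a shell pair at distance in `(11/10·d, 131/100·d)`,
is NOT robustly good at tolerance `≤ 1/20` — by counting, with no search over isometries.  `[folklore]`.
-/

noncomputable section

namespace Summit.AtomisticToContinuum.Crystallization.Theorems.FrustratedLawDichotomyRobustGoodSignature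

open Literature.Geometry.DiscreteGeometry

/-! ## §1. Integer facts about the two patterns -/

/-- fcc: four contacts (squared norm of the difference `2`), everything else at squared norm `≥ 4`. [folklore] -/
theorem fcc_contacts : ∀ v ∈ fccInt, (fccInt.filter fun w => w ≠ v ∧ sqNormInt (v - w) = 2).card = 4 ∧
    ∀ w ∈ fccInt, w ≠ v → sqNormInt (v - w) = 2 ∨ 4 ≤ sqNormInt (v - w) := by decide

/-- hcp: four contacts (squared norm of the difference `18`), everything else at squared norm `≥ 36`. [folklore] -/
theorem hcp_contacts : ∀ v ∈ hcpInt, (hcpInt.filter fun w => w ≠ v ∧ sqNormInt (v - w) = 18).card = 4 ∧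
    ∀ w ∈ hcpInt, w ≠ v → sqNormInt (v - w) = 18 ∨ 36 ≤ sqNormInt (v - w) := by decide

/-! ## §2. Distances in a scaled pattern -/

/-- `dist (v/√N) (w/√N) = √(|v − w|²/N)`. [folklore] -/
theorem dist_scaled (N : ℕ) (hN : N ≠ 0) (v w : Fin 3 → ℤ) :
    dist ((Real.sqrt N)⁻¹ • intVec v : EuclideanSpace ℝ (Fin 3)) ((Real.sqrt N)⁻¹ • intVec w) =
      Real.sqrt ((sqNormInt (v - w) : ℝ) / N) := by
  have hpos : (0 : ℝ) < Real.sqrt N := by positivity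
  rw [dist_eq_norm, ← smul_sub, intVec_sub, norm_smul, norm_inv, Real.norm_of_nonneg hpos.le, norm_intVec,
    Real.sqrt_div' _ (Nat.cast_nonneg N), div_eq_inv_mul]

/-- In a scaled pattern with «contact norm» `N` and «second norm» `≥ 2N`: two distinct points are at distance `1` or at distance `≥ √2`,
according to the integer dichotomy. [folklore] -/
theorem dist_eq_one_or_sqrt_two_le {S : Finset (Fin 3 → ℤ)} {N : ℕ} (hN : N ≠ 0)
    (hS : ∀ v ∈ S, ∀ w ∈ S, w ≠ v → sqNormInt (v - w) = N ∨ 2 * (N : ℤ) ≤ sqNormInt (v - w))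
    {v w : Fin 3 → ℤ} (hv : v ∈ S) (hw : w ∈ S) (hvw : w ≠ v) :
    (sqNormInt (v - w) = N ∧ dist ((Real.sqrt N)⁻¹ • intVec v : EuclideanSpace ℝ (Fin 3)) ((Real.sqrt N)⁻¹ • intVec w) = 1) ∨
    (2 * (N : ℤ) ≤ sqNormInt (v - w) ∧
      Real.sqrt 2 ≤ dist ((Real.sqrt N)⁻¹ • intVec v : EuclideanSpace ℝ (Fin 3)) ((Real.sqrt N)⁻¹ • intVec w)) := by
  have hNpos : (0 : ℝ) < N := by exact_mod_cast Nat.pos_of_ne_zero hN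
  rw [dist_scaled N hN]
  rcases hS v hv w hw hvw with h | h
  · left
    refine ⟨h, ?_⟩
    rw [h, Int.cast_natCast, div_self hNpos.ne', Real.sqrt_one]
  · right
    refine ⟨h, Real.sqrt_le_sqrt ?_⟩
    rw [le_div_iff₀ hNpos]
    exact_mod_cast h

/-! ## §3. Shell distances follow pattern distances -/

/-- For a shell `‖(t u − p) − d•A u‖ ≤ η·d`: `|dist (t u) (t v) − d·dist u v| ≤ 2η·d`. [folklore] -/
theorem dist_shell_sub_le {Pat : Finset (EuclideanSpace ℝ (Fin 3))} {p : EuclideanSpace ℝ (Fin 3)} {d η : ℝ} (hd : 0 ≤ d)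
    {A : EuclideanSpace ℝ (Fin 3) →ₗᵢ[ℝ] EuclideanSpace ℝ (Fin 3)} {t : ↥Pat → EuclideanSpace ℝ (Fin 3)}
    (ht : ∀ u : ↥Pat, ‖(t u - p) - d • A (u : EuclideanSpace ℝ (Fin 3))‖ ≤ η * d) (u v : ↥Pat) :
    |dist (t u) (t v) - d * dist (u : EuclideanSpace ℝ (Fin 3)) v| ≤ 2 * η * d := by
  have h1 : dist (d • A (u : EuclideanSpace ℝ (Fin 3))) (d • A (v : EuclideanSpace ℝ (Fin 3))) =
      d * dist (u : EuclideanSpace ℝ (Fin 3)) v := by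
    rw [dist_smul₀, Real.norm_of_nonneg hd, A.dist_map]
  have h2 : dist (t u - p) (t v - p) = dist (t u) (t v) := by rw [dist_sub_right]
  have htu : dist (t u - p) (d • A (u : EuclideanSpace ℝ (Fin 3))) ≤ η * d := by rw [dist_eq_norm]; exact ht u
  have htv : dist (t v - p) (d • A (v : EuclideanSpace ℝ (Fin 3))) ≤ η * d := by rw [dist_eq_norm]; exact ht v
  have k1 := abs_dist_sub_le (t u - p) (d • A (u : EuclideanSpace ℝ (Fin 3))) (t v - p)
  have k2 := abs_dist_sub_le (t v - p) (d • A (v : EuclideanSpace ℝ (Fin 3))) (d • A (u : EuclideanSpace ℝ (Fin 3)))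
  rw [h2] at k1
  rw [dist_comm (t v - p) (d • A (u : EuclideanSpace ℝ (Fin 3))), dist_comm (d • A (v : EuclideanSpace ℝ (Fin 3))), h1] at k2
  have k1' := abs_le.1 k1
  have k2' := abs_le.1 k2
  rw [abs_le]
  constructor <;> linarith

/-- **Dichotomy for a scaled-pattern shell**: `η ≤ 1/20` ⟹ two distinct shell atoms are at distance `≤ 11/10·d` (pattern contacts) or
`≥ 131/100·d` (pattern distance `≥ √2`). [folklore] -/
theorem shell_dichotomy {S : Finset (Fin 3 → ℤ)} {N : ℕ} (hN : N ≠ 0)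
    (hS : ∀ v ∈ S, ∀ w ∈ S, w ≠ v → sqNormInt (v - w) = N ∨ 2 * (N : ℤ) ≤ sqNormInt (v - w))
    {p : EuclideanSpace ℝ (Fin 3)} {d η : ℝ} (hd : 0 ≤ d) (hη : η ≤ 1 / 20)
    {A : EuclideanSpace ℝ (Fin 3) →ₗᵢ[ℝ] EuclideanSpace ℝ (Fin 3)} {t : ↥(scaledPattern S N) → EuclideanSpace ℝ (Fin 3)}
    (ht : ∀ u : ↥(scaledPattern S N), ‖(t u - p) - d • A (u : EuclideanSpace ℝ (Fin 3))‖ ≤ η * d)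
    (u v : ↥(scaledPattern S N)) (huv : u ≠ v) :
    (dist (u : EuclideanSpace ℝ (Fin 3)) v = 1 ∧ dist (t u) (t v) ≤ 11 / 10 * d) ∨
    (Real.sqrt 2 ≤ dist (u : EuclideanSpace ℝ (Fin 3)) v ∧ 131 / 100 * d ≤ dist (t u) (t v)) := by
  obtain ⟨a, ha, hau⟩ := Finset.mem_image.1 u.2
  obtain ⟨b, hb, hbv⟩ := Finset.mem_image.1 v.2
  have hab : b ≠ a := by
    rintro rfl; exact huv (Subtype.ext (by rw [← hau, ← hbv]))
  have hs := dist_shell_sub_le hd ht u v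
  have hs' := abs_le.1 hs
  have hsq : (141421 / 100000 : ℝ) ≤ Real.sqrt 2 := by
    rw [show (141421 / 100000 : ℝ) = Real.sqrt ((141421 / 100000) ^ 2) from (Real.sqrt_sq (by norm_num)).symm]
    exact Real.sqrt_le_sqrt (by norm_num)
  rcases dist_eq_one_or_sqrt_two_le hN hS ha hb hab with ⟨-, h1⟩ | ⟨-, h2⟩
  · left
    rw [hau, hbv] at h1
    refine ⟨h1, ?_⟩
    rw [h1] at hs'
    nlinarith [hs'.2]
  · right
    rw [hau, hbv] at h2
    refine ⟨h2, ?_⟩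
    have : d * Real.sqrt 2 ≤ d * dist (u : EuclideanSpace ℝ (Fin 3)) v := mul_le_mul_of_nonneg_left h2 hd
    nlinarith [hs'.1, mul_le_mul_of_nonneg_left hsq hd]

/-- **Exactly four contacts in a scaled-pattern shell** (`η ≤ 1/20`): the shell atoms within `11/10·d` of `t u` are exactly the images of the
four pattern contacts of `u`. [folklore] -/
theorem shell_four_contacts {S : Finset (Fin 3 → ℤ)} {N : ℕ} (hN : N ≠ 0)
    (hS : ∀ v ∈ S, ∀ w ∈ S, w ≠ v → sqNormInt (v - w) = N ∨ 2 * (N : ℤ) ≤ sqNormInt (v - w))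
    (hfour : ∀ v ∈ S, (S.filter fun w => w ≠ v ∧ sqNormInt (v - w) = N).card = 4)
    {p : EuclideanSpace ℝ (Fin 3)} {d η : ℝ} (hd : 0 < d) (hη : η ≤ 1 / 20)
    {A : EuclideanSpace ℝ (Fin 3) →ₗᵢ[ℝ] EuclideanSpace ℝ (Fin 3)} {t : ↥(scaledPattern S N) → EuclideanSpace ℝ (Fin 3)}
    (ht : ∀ u : ↥(scaledPattern S N), ‖(t u - p) - d • A (u : EuclideanSpace ℝ (Fin 3))‖ ≤ η * d)
    (u : ↥(scaledPattern S N)) :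
    Nat.card {v : ↥(scaledPattern S N) // v ≠ u ∧ dist (t u) (t v) ≤ 11 / 10 * d} = 4 := by
  classical
  obtain ⟨a, ha, hau⟩ := Finset.mem_image.1 u.2
  rw [← hfour a ha, ← Nat.card_eq_finsetCard]
  -- the scaling map `w ↦ w/√N` restricted to the contacts of `a` is a bijection onto the near shell atoms of `u`
  have hinj := scaledPattern_map_injective hN
  refine Nat.card_congr ?_
  refine Equiv.ofBijective (fun v => ⟨(Finset.mem_image.1 v.1.2).choose, ?_⟩) ⟨?_, ?_⟩
  · -- well-defined: the integer preimage of a near shell atom is a contact of `a`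
    obtain ⟨hb, hbv⟩ := (Finset.mem_image.1 v.1.2).choose_spec
    set b := (Finset.mem_image.1 v.1.2).choose
    rw [Finset.mem_filter]
    refine ⟨hb, ?_, ?_⟩
    · rintro rfl
      exact v.2.1 (Subtype.ext (by rw [← hau, ← hbv]))
    · have hne : u ≠ v.1 := fun h => v.2.1 h.symm
      rcases shell_dichotomy hN hS hd.le hη ht u v.1 hne with ⟨h1, -⟩ | ⟨-, h2⟩
      · have hab : b ≠ a := by
          rintro h; exact v.2.1 (Subtype.ext (by rw [← hau, ← hbv, h]))
        rcases hS a ha b hb hab with h | h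
        · exact h
        · exfalso
          have := dist_eq_one_or_sqrt_two_le hN hS ha hb hab
          rw [hau, hbv] at this
          rcases this with ⟨h', -⟩ | ⟨-, h'⟩
          · exact absurd h' (by omega)
          · have hsq : (1 : ℝ) < Real.sqrt 2 := by
              rw [show (1 : ℝ) = Real.sqrt 1 from Real.sqrt_one.symm]; exact Real.sqrt_lt_sqrt (by norm_num) (by norm_num)
            linarith
      · linarith [v.2.2]
  · -- injective
    intro v₁ v₂ h
    apply Subtype.ext; apply Subtype.ext
    have e1 := (Finset.mem_image.1 v₁.1.2).choose_spec.2
    have e2 := (Finset.mem_image.1 v₂.1.2).choose_spec.2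
    have hc : (Finset.mem_image.1 v₁.1.2).choose = (Finset.mem_image.1 v₂.1.2).choose := congrArg Subtype.val h
    rw [← e1, ← e2, hc]
  · -- surjective: every contact `b` of `a` gives a near shell atom
    intro b
    obtain ⟨hb, hba, hsq⟩ := Finset.mem_filter.1 b.2
    let v : ↥(scaledPattern S N) := ⟨(Real.sqrt N)⁻¹ • intVec (b : Fin 3 → ℤ), Finset.mem_image_of_mem _ hb⟩
    have hvu : v ≠ u := by
      intro h
      have : (v : EuclideanSpace ℝ (Fin 3)) = (u : EuclideanSpace ℝ (Fin 3)) := congrArg Subtype.val h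
      rw [← hau] at this
      exact hba (hinj this)
    have hnear : dist (t u) (t v) ≤ 11 / 10 * d := by
      rcases shell_dichotomy hN hS hd.le hη ht u v hvu.symm with ⟨-, h1⟩ | ⟨h2, -⟩
      · exact h1
      · exfalso
        have hd1 : dist (u : EuclideanSpace ℝ (Fin 3)) v = 1 := by
          have := dist_scaled N hN a b
          rw [hau] at this
          change dist (u : EuclideanSpace ℝ (Fin 3)) (v : EuclideanSpace ℝ (Fin 3)) = _ at this
          rw [this, hsq, Int.cast_natCast, div_self (by exact_mod_cast hN : (N : ℝ) ≠ 0), Real.sqrt_one]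
        rw [hd1] at h2
        have hsq2 : (1 : ℝ) < Real.sqrt 2 := by
          rw [show (1 : ℝ) = Real.sqrt 1 from Real.sqrt_one.symm]; exact Real.sqrt_lt_sqrt (by norm_num) (by norm_num)
        linarith
    refine ⟨⟨v, hvu, hnear⟩, ?_⟩
    apply Subtype.ext
    apply hinj
    change (Real.sqrt N)⁻¹ • intVec ((Finset.mem_image.1 v.2).choose : Fin 3 → ℤ) = (Real.sqrt N)⁻¹ • intVec (b : Fin 3 → ℤ)
    exact (Finset.mem_image.1 v.2).choose_spec.2

/-! ## §4. The two patterns -/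

/-- **CNA dichotomy, fcc shell**. [folklore] -/
theorem robustGood_dichotomy_fcc {p : EuclideanSpace ℝ (Fin 3)} {d η : ℝ} (hd : 0 ≤ d) (hη : η ≤ 1 / 20)
    {A : EuclideanSpace ℝ (Fin 3) →ₗᵢ[ℝ] EuclideanSpace ℝ (Fin 3)} {t : ↥fccKissingPattern → EuclideanSpace ℝ (Fin 3)}
    (ht : ∀ u : ↥fccKissingPattern, ‖(t u - p) - d • A (u : EuclideanSpace ℝ (Fin 3))‖ ≤ η * d)
    (u v : ↥fccKissingPattern) (huv : u ≠ v) :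
    (dist (u : EuclideanSpace ℝ (Fin 3)) v = 1 ∧ dist (t u) (t v) ≤ 11 / 10 * d) ∨
    (Real.sqrt 2 ≤ dist (u : EuclideanSpace ℝ (Fin 3)) v ∧ 131 / 100 * d ≤ dist (t u) (t v)) :=
  shell_dichotomy (S := fccInt) (N := 2) (by norm_num)
    (fun v hv w hw hwv => by
      rcases (fcc_contacts v hv).2 w hw hwv with h | h
      · exact Or.inl (by exact_mod_cast h)
      · exact Or.inr (by push_cast; omega))
    hd hη ht u v huv

/-- **CNA dichotomy, hcp shell**. [folklore] -/
theorem robustGood_dichotomy_hcp {p : EuclideanSpace ℝ (Fin 3)} {d η : ℝ} (hd : 0 ≤ d) (hη : η ≤ 1 / 20)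
    {A : EuclideanSpace ℝ (Fin 3) →ₗᵢ[ℝ] EuclideanSpace ℝ (Fin 3)} {t : ↥hcpKissingPattern → EuclideanSpace ℝ (Fin 3)}
    (ht : ∀ u : ↥hcpKissingPattern, ‖(t u - p) - d • A (u : EuclideanSpace ℝ (Fin 3))‖ ≤ η * d)
    (u v : ↥hcpKissingPattern) (huv : u ≠ v) :
    (dist (u : EuclideanSpace ℝ (Fin 3)) v = 1 ∧ dist (t u) (t v) ≤ 11 / 10 * d) ∨
    (Real.sqrt 2 ≤ dist (u : EuclideanSpace ℝ (Fin 3)) v ∧ 131 / 100 * d ≤ dist (t u) (t v)) :=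
  shell_dichotomy (S := hcpInt) (N := 18) (by norm_num)
    (fun v hv w hw hwv => by
      rcases (hcp_contacts v hv).2 w hw hwv with h | h
      · exact Or.inl (by exact_mod_cast h)
      · exact Or.inr (by push_cast; omega))
    hd hη ht u v huv

/-- **Exactly four contacts, fcc shell**. [folklore] -/
theorem robustGood_four_contacts_fcc {p : EuclideanSpace ℝ (Fin 3)} {d η : ℝ} (hd : 0 < d) (hη : η ≤ 1 / 20)
    {A : EuclideanSpace ℝ (Fin 3) →ₗᵢ[ℝ] EuclideanSpace ℝ (Fin 3)} {t : ↥fccKissingPattern → EuclideanSpace ℝ (Fin 3)}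
    (ht : ∀ u : ↥fccKissingPattern, ‖(t u - p) - d • A (u : EuclideanSpace ℝ (Fin 3))‖ ≤ η * d) (u : ↥fccKissingPattern) :
    Nat.card {v : ↥fccKissingPattern // v ≠ u ∧ dist (t u) (t v) ≤ 11 / 10 * d} = 4 :=
  shell_four_contacts (S := fccInt) (N := 2) (by norm_num)
    (fun v hv w hw hwv => by
      rcases (fcc_contacts v hv).2 w hw hwv with h | h
      · exact Or.inl (by exact_mod_cast h)
      · exact Or.inr (by push_cast; omega))
    (fun v hv => by exact_mod_cast (fcc_contacts v hv).1) hd hη ht u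

/-- **Exactly four contacts, hcp shell**. [folklore] -/
theorem robustGood_four_contacts_hcp {p : EuclideanSpace ℝ (Fin 3)} {d η : ℝ} (hd : 0 < d) (hη : η ≤ 1 / 20)
    {A : EuclideanSpace ℝ (Fin 3) →ₗᵢ[ℝ] EuclideanSpace ℝ (Fin 3)} {t : ↥hcpKissingPattern → EuclideanSpace ℝ (Fin 3)}
    (ht : ∀ u : ↥hcpKissingPattern, ‖(t u - p) - d • A (u : EuclideanSpace ℝ (Fin 3))‖ ≤ η * d) (u : ↥hcpKissingPattern) :
    Nat.card {v : ↥hcpKissingPattern // v ≠ u ∧ dist (t u) (t v) ≤ 11 / 10 * d} = 4 :=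
  shell_four_contacts (S := hcpInt) (N := 18) (by norm_num)
    (fun v hv w hw hwv => by
      rcases (hcp_contacts v hv).2 w hw hwv with h | h
      · exact Or.inl (by exact_mod_cast h)
      · exact Or.inr (by push_cast; omega))
    (fun v hv => by exact_mod_cast (hcp_contacts v hv).1) hd hη ht u

end Summit.AtomisticToContinuum.Crystallization.Theorems.FrustratedLawDichotomyRobustGoodSignature

end
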